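import Literature.AlgebraicGeometry.Resolution.AffineDomainEquidim
import Mathlib.RingTheory.Ideal.MinimalPrime.Localization
import Mathlib.RingTheory.Localization.Ideal
import Mathlib.RingTheory.Spectrum.Prime.RingHom
import HarnessLib

/-!
# Dimensions at the primes over an ideal in terms of its minimal primes; local dimensions at
# the closed points of an equidimensional ideal of an affine algebra

Topic: `Literature/AlgebraicGeometry/Resolution`. Pure commutative algebra serving the global step
of Kawasaki's Macaulayfication (Kawasaki 2000, Thm. 5.1, p. 2539: the forms `z_1, …, z_d` are
chosen one after the other so that every irreducible component of `X ∩ V(z_{i+1}, …, z_d)` has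
dimension `i`; at a closed point `p` the forms vanishing there are then part of a system of
parameters of `𝒪_{X,p}`, i.e. the local dimensions drop by the right amount). The component
count lives with the form selection (`KawasakiFormSelection`); this file turns such a count —
"every minimal prime `𝔮` of `J` has `dim A/𝔮 = e` (resp. `≤ e`)" — into the dimensions that the
local analysis at a point reads:

* `height_map_quotientMk_eq_orderHeight`, `height_map_quotientMk_anti`,
  `height_map_quotientMk_le_of_forall_minimalPrimes` — heights `ht(𝔭/J)` in `A/J` (any
  commutative ring `A`): heights in the subposet `V(J) ⊆ Spec A`, antitone in `J`, and bounded
  by the heights `ht(𝔭/𝔮)` over the minimal primes `𝔮 ⊆ 𝔭` of `J`;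
* `height_map_quotientMk_le_of_forall_ringKrullDim_le`, `ringKrullDim_quotient_le_of_forall_minimalPrimes`,
  `ringKrullDim_quotient_eq_of_forall_minimalPrimes` — hence `ht(𝔭/J) ≤ e` and `dim A/J ≤ e`
  (`= e`) when `dim A/𝔮 ≤ e` (`= e`) for the minimal primes `𝔮` of `J`;
* `ringKrullDim_localization_quotient_map_eq_height`, `ringKrullDim_localization_quotient_map_le`
  — the same for the local rings `A_𝔭/JA_𝔭 = (A/J)_{𝔭/J}` (Matsumura Thm. 4.2), whose dimension
  is `ht(𝔭/J)`: `dim A_𝔭/JA_𝔭 ≤ e`;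
* `height_map_quotientMk_eq_of_isMaximal`, `ringKrullDim_localization_map_quotientMk_eq`,
  `ringKrullDim_localization_atPrime_quotient_eq`, `ringKrullDim_localization_quotient_map_eq` —
  **at the closed points of an affine algebra** (`A` of finite type over a field, every minimal
  prime `𝔮` of `J` with `dim A/𝔮 = e`): `ht(𝔪/J) = dim (A/J)_𝔪 = dim A_𝔪/JA_𝔪 = e` at every
  maximal ideal `𝔪 ⊇ J` (maximal ideals of the affine domains `A/𝔮` have height `dim A/𝔮`,
  `height_eq_ringKrullDim_of_isMaximal`, Matsumura §5).

Everything is PROVED; no definitions, no named facts.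

## References

* T. Kawasaki, *On Macaulayfication of Noetherian schemes*, Trans. AMS 352 (2000) 2517–2552,
  proof of Thm. 5.1 (p. 2539). [Kawasaki2000]
* H. Matsumura, *Commutative Ring Theory*, CUP 1986: §1 p. 1 (ideals of `A/I`), Ex. 1.5,
  Thm. 4.2 (`A_S/IA_S ≅ (A/I)_S̄`), Ex. 4.4 (`Spec (A/I) ≅ V(I)`), §5 p. 30–31 (`ht`, `coht`,
  `ht 𝔭 = dim A_𝔭`), Thm. 5.6 and Ex. 5.1. [Matsumura1987]
-/

noncomputable section

open Ideal

namespace Literature.AlgebraicGeometry.Resolution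

universe u

/-! ## Heights and dimensions over an ideal, in terms of its minimal primes -/

section Quotient

variable {A : Type u} [CommRing A]

/-- A prime containing `J` is a point of the closed set `V(J) ⊆ Spec A` (plumbing for the
statements below). [folklore] -/
private theorem mem_zeroLocus_of_le {J 𝔭 : Ideal A} [𝔭.IsPrime] (h : J ≤ 𝔭) :
    (⟨𝔭, inferInstance⟩ : PrimeSpectrum A) ∈ PrimeSpectrum.zeroLocus (J : Set A) := by
  rw [PrimeSpectrum.mem_zeroLocus]
  exact fun x hx => h hx

/-- **The height of `𝔭/J` in `A/J` is the height of the point `𝔭` in the subposet `V(J)` of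
`Spec A`** — Matsumura §5, p. 30: `ht 𝔭` is the supremum of the lengths of chains of primes
descending from `𝔭`, read in `Spec (A/J) ≅ V(J)` (Ex. 4.4; Mathlib
`Ideal.primeSpectrumQuotientOrderIsoZeroLocus`). [cite: Matsumura1987, §5 p. 30 and Ex. 4.4] -/
theorem height_map_quotientMk_eq_orderHeight {J 𝔭 : Ideal A} [𝔭.IsPrime] (h : J ≤ 𝔭) :
    (𝔭.map (Ideal.Quotient.mk J)).height =
      Order.height (⟨⟨𝔭, inferInstance⟩, mem_zeroLocus_of_le h⟩ :
        PrimeSpectrum.zeroLocus (R := A) (J : Set A)) := by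
  haveI := Ideal.isPrime_map_quotientMk_of_isPrime h
  have he : Ideal.primeSpectrumQuotientOrderIsoZeroLocus J
      ⟨𝔭.map (Ideal.Quotient.mk J), inferInstance⟩ =
        ⟨⟨𝔭, inferInstance⟩, mem_zeroLocus_of_le h⟩ := by
    apply Subtype.ext
    apply PrimeSpectrum.ext
    exact Ideal.comap_map_mk h
  rw [← he, Order.height_orderIso]
  exact PrimeSpectrum.height_eq_orderHeight ⟨𝔭.map (Ideal.Quotient.mk J), inferInstance⟩

/-- **Heights in quotients are antitone in the ideal**: for `J ≤ J' ≤ 𝔭` with `𝔭` prime,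
`ht(𝔭/J') ≤ ht(𝔭/J)` — a chain of primes between `J'` and `𝔭` is a chain between `J` and `𝔭`
(`V(J') ⊆ V(J)`, Matsumura §5 p. 30 with Ex. 4.4). [cite: Matsumura1987, §5 p. 30 and Ex. 4.4] -/
theorem height_map_quotientMk_anti {J J' 𝔭 : Ideal A} [𝔭.IsPrime] (hJJ' : J ≤ J')
    (h : J' ≤ 𝔭) :
    (𝔭.map (Ideal.Quotient.mk J')).height ≤ (𝔭.map (Ideal.Quotient.mk J)).height := by
  rw [height_map_quotientMk_eq_orderHeight h, height_map_quotientMk_eq_orderHeight (hJJ'.trans h)]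
  have hsub : PrimeSpectrum.zeroLocus (R := A) (J' : Set A) ⊆ PrimeSpectrum.zeroLocus (J : Set A) :=
    PrimeSpectrum.zeroLocus_anti_mono (fun x hx => hJJ' hx)
  exact Order.height_le_height_apply_of_strictMono (Set.inclusion hsub) (fun _ _ hab => hab) _

/-- A chain of primes containing `J` is a chain of primes containing a minimal prime `𝔮` of `J`
(one below its smallest member, Matsumura Ex. 1.5), of the same length and with the same top.
[folklore] -/
private theorem exists_ltSeries_zeroLocus_minimalPrimes {J : Ideal A}
    (p : LTSeries (PrimeSpectrum.zeroLocus (R := A) (J : Set A))) :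
    ∃ 𝔮 ∈ J.minimalPrimes, ∃ p' : LTSeries (PrimeSpectrum.zeroLocus (R := A) (𝔮 : Set A)),
      p'.length = p.length ∧ (p'.last : PrimeSpectrum A) = p.last := by
  -- the head of the chain contains `J`, hence a minimal prime `𝔮` of `J`
  have hJ0 : J ≤ (p.head : PrimeSpectrum A).asIdeal := fun x hx =>
    (PrimeSpectrum.mem_zeroLocus _ _).mp p.head.2 hx
  obtain ⟨𝔮, h𝔮min, h𝔮le⟩ := Ideal.exists_minimalPrimes_le hJ0
  -- every term of the chain contains `𝔮`
  have hmem : ∀ i, (p i : PrimeSpectrum A) ∈ PrimeSpectrum.zeroLocus (𝔮 : Set A) := by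
    intro i
    rw [PrimeSpectrum.mem_zeroLocus]
    have hmono : p.head ≤ p i := p.strictMono.monotone (Fin.zero_le i)
    exact fun x hx => hmono (h𝔮le hx)
  exact ⟨𝔮, h𝔮min, ⟨p.length, fun i => ⟨(p i : PrimeSpectrum A), hmem i⟩, fun i => p.step i⟩,
    rfl, rfl⟩

/-- **Heights in a quotient are governed by the minimal primes**: for `J ≤ 𝔭` with `𝔭` prime,
if `ht(𝔭/𝔮) ≤ n` for every minimal prime `𝔮 ⊆ 𝔭` of `J`, then `ht(𝔭/J) ≤ n` — a chain of
primes of `A/J` descending from `𝔭` ends in a prime containing some minimal prime `𝔮` of `J`,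
so it is a chain of primes of `A/𝔮` (Matsumura §5 p. 30: heights as lengths of chains; Ex. 1.5:
a prime containing `J` contains a minimal prime over `J`). [cite: Matsumura1987, §5 p. 30, Ex. 1.5 and Ex. 4.4] -/
theorem height_map_quotientMk_le_of_forall_minimalPrimes {J 𝔭 : Ideal A} [𝔭.IsPrime]
    (h : J ≤ 𝔭) {n : ℕ∞}
    (hn : ∀ 𝔮 ∈ J.minimalPrimes, (h𝔮 : 𝔮 ≤ 𝔭) → (𝔭.map (Ideal.Quotient.mk 𝔮)).height ≤ n) :
    (𝔭.map (Ideal.Quotient.mk J)).height ≤ n := by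
  rw [height_map_quotientMk_eq_orderHeight h]
  refine Order.height_le_iff'.mpr fun p hp => ?_
  obtain ⟨𝔮, h𝔮min, p', hlen, hlast'⟩ := exists_ltSeries_zeroLocus_minimalPrimes p
  have hlastval : (p'.last : PrimeSpectrum A) = ⟨𝔭, inferInstance⟩ := by
    rw [hlast', hp]
  have h𝔮𝔭 : 𝔮 ≤ 𝔭 := by
    have hl := p'.last.2
    rw [hlastval, PrimeSpectrum.mem_zeroLocus] at hl
    exact fun x hx => hl hx
  have hlast : p'.last = ⟨⟨𝔭, inferInstance⟩, mem_zeroLocus_of_le h𝔮𝔭⟩ := Subtype.ext hlastval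
  have hbound := hn 𝔮 h𝔮min h𝔮𝔭
  rw [height_map_quotientMk_eq_orderHeight h𝔮𝔭, ← hlast] at hbound
  rw [← hlen]
  exact (Order.length_le_height_last (p := p')).trans hbound

/-- **`ht(𝔭/J) ≤ e` when the minimal primes `𝔮 ⊆ 𝔭` of `J` have `dim A/𝔮 ≤ e`**
(`ht(𝔭/𝔮) ≤ dim A/𝔮`: `ht + coht ≤ dim`, Matsumura §5 p. 30).
[cite: Matsumura1987, §5 p. 30, Ex. 1.5 and Ex. 4.4] -/
theorem height_map_quotientMk_le_of_forall_ringKrullDim_le {J 𝔭 : Ideal A} [𝔭.IsPrime]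
    (h : J ≤ 𝔭) {n : ℕ∞}
    (hn : ∀ 𝔮 ∈ J.minimalPrimes, (h𝔮 : 𝔮 ≤ 𝔭) → ringKrullDim (A ⧸ 𝔮) ≤ n) :
    (𝔭.map (Ideal.Quotient.mk J)).height ≤ n := by
  refine height_map_quotientMk_le_of_forall_minimalPrimes h fun 𝔮 h𝔮 h𝔮𝔭 => ?_
  haveI := Ideal.isPrime_map_quotientMk_of_isPrime (I := 𝔮) h𝔮𝔭
  have h1 : ((𝔭.map (Ideal.Quotient.mk 𝔮)).height : WithBot ℕ∞) ≤ n :=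
    (Ideal.height_le_ringKrullDim_of_isPrime (I := 𝔭.map (Ideal.Quotient.mk 𝔮))).trans
      (hn 𝔮 h𝔮 h𝔮𝔭)
  exact_mod_cast h1

/-- **`dim A/J ≤ e` when every minimal prime `𝔮` of `J` has `dim A/𝔮 ≤ e`** (a chain of primes
containing `J` is a chain of primes containing a minimal prime of `J`; Matsumura §5 p. 30: `dim`
is the combinatorial dimension of `Spec`, Ex. 4.4, Ex. 1.5).
[cite: Matsumura1987, §5 p. 30, Ex. 1.5 and Ex. 4.4] -/
theorem ringKrullDim_quotient_le_of_forall_minimalPrimes {J : Ideal A} {n : WithBot ℕ∞}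
    (hn : ∀ 𝔮 ∈ J.minimalPrimes, ringKrullDim (A ⧸ 𝔮) ≤ n) : ringKrullDim (A ⧸ J) ≤ n := by
  rw [ringKrullDim, Order.krullDim_eq_of_orderIso (Ideal.primeSpectrumQuotientOrderIsoZeroLocus J),
    Order.krullDim]
  refine iSup_le fun p => ?_
  obtain ⟨𝔮, h𝔮min, p', hlen, -⟩ := exists_ltSeries_zeroLocus_minimalPrimes p
  calc (p.length : WithBot ℕ∞) = p'.length := by rw [hlen]
    _ ≤ Order.krullDim (PrimeSpectrum.zeroLocus (R := A) (𝔮 : Set A)) :=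
      Order.LTSeries.length_le_krullDim p'
    _ = ringKrullDim (A ⧸ 𝔮) := by
      rw [ringKrullDim, Order.krullDim_eq_of_orderIso (Ideal.primeSpectrumQuotientOrderIsoZeroLocus 𝔮)]
    _ ≤ n := hn 𝔮 h𝔮min

/-- **`dim A/J = e` for a proper ideal `J` all of whose minimal primes `𝔮` have `dim A/𝔮 = e`**
(`≤` by the previous statement; `≥` from the surjection `A/J ↠ A/𝔮`).
[cite: Matsumura1987, §5 p. 30, Ex. 1.5 and Ex. 4.4] -/
theorem ringKrullDim_quotient_eq_of_forall_minimalPrimes {J : Ideal A} (hJ : J ≠ ⊤)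
    {n : WithBot ℕ∞} (hn : ∀ 𝔮 ∈ J.minimalPrimes, ringKrullDim (A ⧸ 𝔮) = n) :
    ringKrullDim (A ⧸ J) = n := by
  apply le_antisymm (ringKrullDim_quotient_le_of_forall_minimalPrimes fun 𝔮 h𝔮 => (hn 𝔮 h𝔮).le)
  obtain ⟨⟨𝔮, h𝔮⟩⟩ := Ideal.nonempty_minimalPrimes hJ
  rw [← hn 𝔮 h𝔮]
  exact ringKrullDim_le_of_surjective (Ideal.quotientMap 𝔮 (RingHom.id A) h𝔮.1.2)
    (Ideal.quotientMap_surjective Function.surjective_id)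

/-- **`dim A_𝔭/JA_𝔭 = ht(𝔭/J)`**: for `J ≤ 𝔭` prime, the ring `A_𝔭/JA_𝔭` is the localization of
`A/J` at `𝔭/J` (Matsumura Thm. 4.2: localization commutes with quotients), whose dimension is
the height of `𝔭/J` (Matsumura §5 p. 30: `ht 𝔭 = dim A_𝔭`).
[cite: Matsumura1987, Thm. 4.2 and §5 p. 30] -/
theorem ringKrullDim_localization_quotient_map_eq_height {J 𝔭 : Ideal A} [𝔭.IsPrime]
    (h : J ≤ 𝔭) :
    ringKrullDim (Localization.AtPrime 𝔭 ⧸ J.map (algebraMap A (Localization.AtPrime 𝔭))) =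
      (𝔭.map (Ideal.Quotient.mk J)).height := by
  set 𝔭bar : Ideal (A ⧸ J) := 𝔭.map (Ideal.Quotient.mk J) with h𝔭bar
  haveI h𝔭barp : 𝔭bar.IsPrime := Ideal.isPrime_map_quotientMk_of_isPrime h
  have hcomap : 𝔭bar.comap (Ideal.Quotient.mk J) = 𝔭 := Ideal.comap_map_mk h
  have hmem : ∀ a : A, Ideal.Quotient.mk J a ∈ 𝔭bar ↔ a ∈ 𝔭 := fun a => by
    rw [← Ideal.mem_comap, hcomap]
  have hM : Algebra.algebraMapSubmonoid (A ⧸ J) 𝔭.primeCompl = 𝔭bar.primeCompl := by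
    ext b
    constructor
    · rintro ⟨a, ha, rfl⟩
      exact fun hb => ha ((hmem a).mp hb)
    · intro hb
      obtain ⟨a, rfl⟩ := Ideal.Quotient.mk_surjective b
      exact ⟨a, fun ha => hb ((hmem a).mpr ha), rfl⟩
  haveI : IsLocalization.AtPrime
      (Localization.AtPrime 𝔭 ⧸ J.map (algebraMap A (Localization.AtPrime 𝔭))) 𝔭bar := by
    have hloc := (inferInstance : IsLocalization (Algebra.algebraMapSubmonoid (A ⧸ J) 𝔭.primeCompl)
      (Localization.AtPrime 𝔭 ⧸ J.map (algebraMap A (Localization.AtPrime 𝔭))))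
    rwa [hM] at hloc
  exact IsLocalization.AtPrime.ringKrullDim_eq_height 𝔭bar
    (Localization.AtPrime 𝔭 ⧸ J.map (algebraMap A (Localization.AtPrime 𝔭)))

/-- **`dim A_𝔭/JA_𝔭 ≤ e` when the minimal primes `𝔮 ⊆ 𝔭` of `J` have `dim A/𝔮 ≤ e`** — the
form in which a component count "`dim A/𝔮 ≤ e` for the minimal primes" is read by the local
analysis at a point (Kawasaki 2000, p. 2539: the chosen forms vanishing at `p` cut `dim 𝒪_{X,p}`
down by their number). [cite: Kawasaki2000, Thm. 5.1 (proof, p. 2539)]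
[cite: Matsumura1987, Thm. 4.2 and §5 p. 30] -/
theorem ringKrullDim_localization_quotient_map_le {J 𝔭 : Ideal A} [𝔭.IsPrime] (h : J ≤ 𝔭)
    {n : ℕ∞} (hn : ∀ 𝔮 ∈ J.minimalPrimes, (h𝔮 : 𝔮 ≤ 𝔭) → ringKrullDim (A ⧸ 𝔮) ≤ n) :
    ringKrullDim (Localization.AtPrime 𝔭 ⧸ J.map (algebraMap A (Localization.AtPrime 𝔭))) ≤ n := by
  rw [ringKrullDim_localization_quotient_map_eq_height h]
  exact_mod_cast height_map_quotientMk_le_of_forall_ringKrullDim_le h hn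

end Quotient

/-! ## Affine algebras: local dimensions at the closed points of an equidimensional ideal -/

section Affine

variable (k : Type u) [Field k] {A : Type u} [CommRing A] [Algebra k A] [Algebra.FiniteType k A]

include k in
/-- **`ht(𝔪/J) = e` at every maximal ideal over an equidimensional ideal.** Let `A` be of finite
type over a field and `J ⊆ A` an ideal all of whose minimal primes `𝔮` have `dim A/𝔮 = e`. Then
for every maximal ideal `𝔪 ⊇ J` the prime `𝔪/J` of `A/J` has height `e`: for each minimal prime
`𝔮 ⊆ 𝔪` of `J`, `𝔪/𝔮` is a maximal ideal of the affine domain `A/𝔮`, of height `dim A/𝔮 = e`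
(Matsumura §5, Thm. 5.6 with Ex. 5.1), and `ht(𝔪/J)` is the largest of these. (Kawasaki 2000,
p. 2539: at a closed point the chosen forms vanishing there are part of a system of parameters.)
[cite: Kawasaki2000, Thm. 5.1 (proof, p. 2539)] [cite: Matsumura1987, §5 Thm. 5.6 and Ex. 5.1] -/
theorem height_map_quotientMk_eq_of_isMaximal {J : Ideal A} {e : ℕ}
    (hJ : ∀ 𝔮 ∈ J.minimalPrimes, ringKrullDim (A ⧸ 𝔮) = e) (𝔪 : Ideal A) [𝔪.IsMaximal]
    (h𝔪 : J ≤ 𝔪) : (𝔪.map (Ideal.Quotient.mk J)).height = e := by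
  have key : ∀ 𝔮 ∈ J.minimalPrimes, 𝔮 ≤ 𝔪 → (𝔪.map (Ideal.Quotient.mk 𝔮)).height = e := by
    intro 𝔮 h𝔮 h𝔮𝔪
    haveI : 𝔮.IsPrime := h𝔮.1.1
    haveI : (𝔪.map (Ideal.Quotient.mk 𝔮)).IsMaximal :=
      Ideal.IsMaximal.map_of_surjective_of_ker_le Ideal.Quotient.mk_surjective
        (by rw [Ideal.mk_ker]; exact h𝔮𝔪)
    have h1 := height_eq_ringKrullDim_of_isMaximal k (𝔪.map (Ideal.Quotient.mk 𝔮))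
    rw [hJ 𝔮 h𝔮] at h1
    exact_mod_cast h1
  apply le_antisymm
  · exact height_map_quotientMk_le_of_forall_minimalPrimes h𝔪
      fun 𝔮 h𝔮 h𝔮𝔪 => (key 𝔮 h𝔮 h𝔮𝔪).le
  · obtain ⟨𝔮, h𝔮, h𝔮𝔪⟩ := Ideal.exists_minimalPrimes_le h𝔪
    rw [← key 𝔮 h𝔮 h𝔮𝔪]
    exact height_map_quotientMk_anti h𝔮.1.2 h𝔮𝔪

include k in
/-- **`dim (A/J)_𝔪 = e`** at every maximal ideal `𝔪 ⊇ J` of an ideal `J` all of whose minimal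
primes `𝔮` have `dim A/𝔮 = e` (the local ring of `Spec A/J` at the closed point `𝔪`, as the
localization of `A/J` at `𝔪/J`; `dim = ht`, Matsumura §5 p. 30).
[cite: Kawasaki2000, Thm. 5.1 (proof, p. 2539)] [cite: Matsumura1987, §5 p. 30, Thm. 5.6 and Ex. 5.1] -/
theorem ringKrullDim_localization_map_quotientMk_eq {J : Ideal A} {e : ℕ}
    (hJ : ∀ 𝔮 ∈ J.minimalPrimes, ringKrullDim (A ⧸ 𝔮) = e) (𝔪 : Ideal A) [𝔪.IsMaximal]
    (h𝔪 : J ≤ 𝔪) :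
    haveI := Ideal.isPrime_map_quotientMk_of_isPrime (I := J) h𝔪
    ringKrullDim (Localization.AtPrime (𝔪.map (Ideal.Quotient.mk J))) = e := by
  haveI := Ideal.isPrime_map_quotientMk_of_isPrime (I := J) h𝔪
  rw [IsLocalization.AtPrime.ringKrullDim_eq_height (𝔪.map (Ideal.Quotient.mk J))
      (Localization.AtPrime (𝔪.map (Ideal.Quotient.mk J))),
    height_map_quotientMk_eq_of_isMaximal k hJ 𝔪 h𝔪]
  rfl

include k in
/-- **`dim (A/J)_𝔐 = e` for every maximal ideal `𝔐` of `A/J`**, `J` an ideal all of whose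
minimal primes `𝔮` have `dim A/𝔮 = e` (the previous statement at `𝔪 = 𝔐 ∩ A`).
[cite: Kawasaki2000, Thm. 5.1 (proof, p. 2539)] [cite: Matsumura1987, §5 p. 30, Thm. 5.6 and Ex. 5.1] -/
theorem ringKrullDim_localization_atPrime_quotient_eq {J : Ideal A} {e : ℕ}
    (hJ : ∀ 𝔮 ∈ J.minimalPrimes, ringKrullDim (A ⧸ 𝔮) = e) (𝔐 : Ideal (A ⧸ J)) [𝔐.IsMaximal] :
    ringKrullDim (Localization.AtPrime 𝔐) = e := by
  haveI : (𝔐.comap (Ideal.Quotient.mk J)).IsMaximal :=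
    Ideal.comap_isMaximal_of_surjective _ Ideal.Quotient.mk_surjective
  have hJ𝔪 : J ≤ 𝔐.comap (Ideal.Quotient.mk J) := fun x hx => by
    rw [Ideal.mem_comap, Ideal.Quotient.eq_zero_iff_mem.mpr hx]
    exact 𝔐.zero_mem
  have hmap : (𝔐.comap (Ideal.Quotient.mk J)).map (Ideal.Quotient.mk J) = 𝔐 :=
    Ideal.map_comap_of_surjective _ Ideal.Quotient.mk_surjective 𝔐
  have hht : 𝔐.height = e := by
    rw [← hmap]
    exact height_map_quotientMk_eq_of_isMaximal k hJ (𝔐.comap (Ideal.Quotient.mk J)) hJ𝔪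
  rw [IsLocalization.AtPrime.ringKrullDim_eq_height 𝔐 (Localization.AtPrime 𝔐), hht]
  rfl

include k in
/-- **`dim A_𝔪/JA_𝔪 = e`** at every maximal ideal `𝔪 ⊇ J` of an ideal `J` all of whose minimal
primes `𝔮` have `dim A/𝔮 = e` — the form in which the count enters Kawasaki's local analysis at a
closed point (`A_𝔪/JA_𝔪 = (A/J)_{𝔪/J}`, Matsumura Thm. 4.2).
[cite: Kawasaki2000, Thm. 5.1 (proof, p. 2539)] [cite: Matsumura1987, Thm. 4.2, §5 Thm. 5.6 and Ex. 5.1] -/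
theorem ringKrullDim_localization_quotient_map_eq {J : Ideal A} {e : ℕ}
    (hJ : ∀ 𝔮 ∈ J.minimalPrimes, ringKrullDim (A ⧸ 𝔮) = e) (𝔪 : Ideal A) [𝔪.IsMaximal]
    (h𝔪 : J ≤ 𝔪) :
    ringKrullDim (Localization.AtPrime 𝔪 ⧸ J.map (algebraMap A (Localization.AtPrime 𝔪))) = e := by
  rw [ringKrullDim_localization_quotient_map_eq_height h𝔪,
    height_map_quotientMk_eq_of_isMaximal k hJ 𝔪 h𝔪]
  rfl

end Affine

end Literature.AlgebraicGeometry.Resolution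

end
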